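import Summits.QuantumFields.QCD.Theses.HeatSlicedQuarks
import Summits.QuantumFields.QCD.Theorems.HeatSlicedQuarksTracedQuadraticParametrixFirstOrderTracedPairingAuxB
import Summits.QuantumFields.QCD.Theorems.HeatSlicedQuarksInterleavedHeatSliceFlowStubFreeColumnProfile
import Summits.QuantumFields.QCD.Theorems.HeatSlicedQuarksInterleavedHeatSliceFlowStubFreeWeightedMoments
import Summits.QuantumFields.QCD.Theorems.HeatSlicedQuarksInterleavedHeatSliceFlowStubHoppingWeightedBounds
import Summits.QuantumFields.QCD.Theorems.HeatSlicedQuarksInterleavedHeatSliceFlowStubColumnIdentificationAuxB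

/-!
# Stub `stub_firstOrderTracedPairing` of line `Sketch`
(crux `Summit.QuantumFields.QCD.Theses.HeatSlicedQuarks.TracedQuadraticParametrix`, item stmt-QuantumFields-17985)

**FirstOrderTracedPairing.**  Let `D = D_W(W,m,1)` be the Wilson–Dirac matrix of an `SU(3)` field `W` on the
four-torus, `D₁ = D_W(1,m,1)` the free one, `E = D − D₁`, `K₁(σ) = e^{-σ D₁ᴴ D₁}`.  In a gauge with link deficits
`3 − Re tr W(z,μ) ≤ C_A (d(x,z)+1)² δ²`, the colour–spin TRACE at `x` of the first-order two-time term is second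
order in the field:
`|Σ_{a,α} (K₁(σ) (DᴴD − D₁ᴴD₁) K₁(τ))((x,a,α),(x,a,α))| ≤ C δ²/√((1+σ)(1+τ))`, `0 ≤ σ, τ ≤ L²`, `m ∈ [-1/2,1]`.

Proof.  `heat_vertex_split_traced`: `K₁(σ)(DᴴD − D₁ᴴD₁)K₁(τ) = (D₁K₁(σ))ᴴ E K₁(τ) + ((D₁K₁(τ))ᴴ E K₁(σ))ᴴ +
(EK₁(σ))ᴴ (EK₁(τ))` (the free kernel is Hermitian).  The two first-order terms are the (B) helper
`norm_firstOrder_traced_le` (colour trace formula, `SU(3)` trace inequality, weighted Cauchy–Schwarz) fed with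
the landed free profiles `stub_freeColumnProfile` (mass factor dropped, `const_exp_mul_div_le`) and moments
`stub_freeWeightedMoments`; the two-vertex term is Cauchy–Schwarz on the twelve columns at `x` with the landed
`stub_hoppingWeightedBounds` and `sum_weight_norm_sq_le_of_profile`.  Output constant
`C = 6144 C_A C_F² M + 144 C_h C_F² M` with `C_F, M, C_h` the (nonnegative parts of the) landed constants.
No unproved named facts are used.
-/

noncomputable section

namespace Summit.QuantumFields.QCD.Cruxes.TracedQuadraticParametrix.Sketch

open Literature.MathematicalPhysics.QuantumLattice Literature.MathematicalPhysics.QuantumFieldTheory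
  Literature.Probability.LatticeModels
open Summit.QuantumFields.QCD.Theses.HeatSlicedQuarks
open Summit.QuantumFields.QCD.Cruxes.InterleavedHeatSliceFlow.Sketch
open Summit.QuantumFields.QCD.Cruxes.SmallFieldUltracontractivity.PointCentredAxialParabolic
open Summit.QuantumFields.QCD.Theorems.SmallFieldUltracontractivity.Negative
open Summit.QuantumFields.QCD.Theorems.HeatSlicedQuarksDaviesGaffney
open scoped Matrix ComplexConjugate

/-! ### Small helpers -/

section Helpers

/-- Cauchy–Schwarz for a diagonal entry of `Pᴴ Q`: `|(Pᴴ Q)(p,p)| ≤ ‖P e_p‖₂ ‖Q e_p‖₂`. -/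
private theorem norm_conjTranspose_mul_apply_le {ι : Type*} [Fintype ι] (P Q : Matrix ι ι ℂ) (p : ι) :
    ‖(Pᴴ * Q) p p‖ ≤ Real.sqrt (∑ q, ‖P q p‖ ^ 2) * Real.sqrt (∑ q, ‖Q q p‖ ^ 2) := by
  rw [Matrix.mul_apply]
  refine (norm_sum_le _ _).trans ?_
  have h : ∀ q, ‖(Pᴴ) p q * Q q p‖ = ‖P q p‖ * ‖Q q p‖ := fun q => by
    rw [norm_mul, Matrix.conjTranspose_apply, norm_star]
  simp only [h]
  exact Real.sum_mul_le_sqrt_mul_sqrt _ _ _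

end Helpers

/-! ### Assembly -/

section Assembly

/-- Entries of a matrix product as `mulVec` of a column (as in `stub_columnIdentification`). -/
private theorem mul_apply_eq_mulVec_col {ι : Type*} [Fintype ι] (A C : Matrix ι ι ℂ) (i j : ι) :
    (A * C) i j = A.mulVec (fun k => C k j) i := by
  simp only [Matrix.mul_apply, Matrix.mulVec, dotProduct]

/-- Cauchy–Schwarz for the traced two-vertex term: if the columns of `P` and `Q` through the twelve indices at
`x` have squared `ℓ²` norms `≤ X`, `≤ Y`, then `|Σ_{a,α} (Pᴴ Q)((x,a,α),(x,a,α))| ≤ 12 √X √Y`. -/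
private theorem norm_sum_conjTranspose_mul_apply_le {L : ℕ} [NeZero L]
    (P Q : Matrix (TorusSite 4 L × Fin 3 × Fin 4) (TorusSite 4 L × Fin 3 × Fin 4) ℂ) (x : TorusSite 4 L)
    {X Y : ℝ} (hP : ∀ (a : Fin 3) (α : Fin 4), ∑ q, ‖P q (x, a, α)‖ ^ 2 ≤ X)
    (hQ : ∀ (a : Fin 3) (α : Fin 4), ∑ q, ‖Q q (x, a, α)‖ ^ 2 ≤ Y) :
    ‖∑ a : Fin 3, ∑ α : Fin 4, (Pᴴ * Q) (x, a, α) (x, a, α)‖ ≤ 12 * (Real.sqrt X * Real.sqrt Y) := by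
  calc ‖∑ a : Fin 3, ∑ α : Fin 4, (Pᴴ * Q) (x, a, α) (x, a, α)‖
      ≤ ∑ a : Fin 3, ∑ α : Fin 4, ‖(Pᴴ * Q) (x, a, α) (x, a, α)‖ :=
        (norm_sum_le _ _).trans (Finset.sum_le_sum fun a _ => norm_sum_le _ _)
    _ ≤ ∑ _a : Fin 3, ∑ _α : Fin 4, Real.sqrt X * Real.sqrt Y := by
        refine Finset.sum_le_sum fun a _ => Finset.sum_le_sum fun α _ => ?_
        exact (norm_conjTranspose_mul_apply_le P Q _).trans (mul_le_mul (Real.sqrt_le_sqrt (hP a α))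
          (Real.sqrt_le_sqrt (hQ a α)) (Real.sqrt_nonneg _) (Real.sqrt_nonneg _))
    _ = 12 * (Real.sqrt X * Real.sqrt Y) := by
        simp only [Finset.sum_const, Finset.card_univ, Fintype.card_fin, nsmul_eq_mul]
        ring

/-- **The traced splitting of the first-order two-time term.**  For Hermitian `P, Q` and any `A, B`:
`P (AᴴA − BᴴB) Q = (BP)ᴴ (A−B) Q + ((BQ)ᴴ (A−B) P)ᴴ + ((A−B)P)ᴴ ((A−B)Q)`
(`AᴴA − BᴴB = Bᴴ E + Eᴴ B + Eᴴ E`, `E = A − B`). -/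
private theorem heat_vertex_split_traced {ι : Type*} [Fintype ι] (A B P Q : Matrix ι ι ℂ) (hP : Pᴴ = P)
    (hQ : Qᴴ = Q) :
    P * (Aᴴ * A - Bᴴ * B) * Q =
      (B * P)ᴴ * (A - B) * Q + ((B * Q)ᴴ * (A - B) * P)ᴴ + ((A - B) * P)ᴴ * ((A - B) * Q) := by
  have h : Aᴴ * A - Bᴴ * B = Bᴴ * (A - B) + (A - B)ᴴ * B + (A - B)ᴴ * (A - B) := by
    simp only [Matrix.conjTranspose_sub, Matrix.mul_sub, Matrix.sub_mul]
    abel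
  rw [h]
  simp only [Matrix.mul_add, Matrix.add_mul, Matrix.conjTranspose_mul, Matrix.conjTranspose_conjTranspose,
    hP, hQ, Matrix.mul_assoc]

/-- Dropping the Gaussian mass factor and the sign of the constant in the free profiles:
`C e^{-t} X / P ≤ max C 0 · (X/P)` for `t, X, P ≥ 0`. -/
private theorem const_exp_mul_div_le {C t X P : ℝ} (ht : 0 ≤ t) (hX : 0 ≤ X) (hP : 0 ≤ P) :
    C * Real.exp (-t) * X / P ≤ max C 0 * (X / P) := by
  rw [mul_div_assoc]
  refine mul_le_mul_of_nonneg_right ?_ (div_nonneg hX hP)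
  rcases le_or_gt 0 C with hC | hC
  · calc C * Real.exp (-t) ≤ C * 1 :=
          mul_le_mul_of_nonneg_left (Real.exp_le_one_iff.2 (by linarith)) hC
      _ ≤ max C 0 := by rw [mul_one]; exact le_max_left _ _
  · exact (mul_nonpos_of_nonpos_of_nonneg hC.le (Real.exp_pos _).le).trans (le_max_right _ _)

/-- **Stub `stub_firstOrderTracedPairing`** (M) of line `Sketch`: the colour–spin trace at `x` of the
first-order two-time term `K₁(σ)(H_W − H₁)K₁(τ)` is second order, `≤ C δ²/√((1+σ)(1+τ))`, in a gauge with
link deficits `≤ C_A (d(x,z)+1)² δ²`.  Split `K₁(σ)(H_W − H₁)K₁(τ) = (D₁K₁(σ))ᴴ E K₁(τ) +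
((D₁K₁(τ))ᴴ E K₁(σ))ᴴ + (EK₁(σ))ᴴ(EK₁(τ))` (`heat_vertex_split_traced`); the two first-order terms by
`norm_firstOrder_traced_le` (colour trace + `SU(3)` trace inequality + weighted Cauchy–Schwarz with the landed
free profiles `stub_freeColumnProfile` and moments `stub_freeWeightedMoments`), the two-vertex term by
Cauchy–Schwarz with the landed `stub_hoppingWeightedBounds`. -/
theorem stub_firstOrderTracedPairing :
    ∀ C_A : ℝ, 0 ≤ C_A → ∃ C : ℝ, ∀ (L : ℕ) [NeZero L]
    (W : GaugeConfig 4 L (Matrix.specialUnitaryGroup (Fin 3) ℂ)) (m : ℝ), m ∈ Set.Icc (-(1 / 2 : ℝ)) 1 →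
    ∀ (x : TorusSite 4 L) (δ : ℝ), 0 ≤ δ →
    (∀ (z : TorusSite 4 L) (μ : Fin 4),
      3 - ((fundamentalRep (Fin 3)) (W (z, μ))).trace.re ≤ C_A * ((torusDist x z : ℝ) + 1) ^ 2 * δ ^ 2) →
    ∀ (σ τ : ℝ), 0 ≤ σ → σ ≤ (L : ℝ) ^ 2 → 0 ≤ τ → τ ≤ (L : ℝ) ^ 2 →
      ‖∑ a : Fin 3, ∑ α : Fin 4,
          (NormedSpace.exp (-(σ : ℂ) •
              ((wilsonDirac (fundamentalRep (Fin 3))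
                  (fun _ : Edge 4 L => (1 : Matrix.specialUnitaryGroup (Fin 3) ℂ)) m 1)ᴴ *
                wilsonDirac (fundamentalRep (Fin 3))
                  (fun _ : Edge 4 L => (1 : Matrix.specialUnitaryGroup (Fin 3) ℂ)) m 1)) *
            ((wilsonDirac (fundamentalRep (Fin 3)) W m 1)ᴴ * wilsonDirac (fundamentalRep (Fin 3)) W m 1 -
              (wilsonDirac (fundamentalRep (Fin 3))
                  (fun _ : Edge 4 L => (1 : Matrix.specialUnitaryGroup (Fin 3) ℂ)) m 1)ᴴ *
                wilsonDirac (fundamentalRep (Fin 3))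
                  (fun _ : Edge 4 L => (1 : Matrix.specialUnitaryGroup (Fin 3) ℂ)) m 1) *
            NormedSpace.exp (-(τ : ℂ) •
              ((wilsonDirac (fundamentalRep (Fin 3))
                  (fun _ : Edge 4 L => (1 : Matrix.specialUnitaryGroup (Fin 3) ℂ)) m 1)ᴴ *
                wilsonDirac (fundamentalRep (Fin 3))
                  (fun _ : Edge 4 L => (1 : Matrix.specialUnitaryGroup (Fin 3) ℂ)) m 1)))
            (x, a, α) (x, a, α)‖ ≤
        C * δ ^ 2 / Real.sqrt ((1 + σ) * (1 + τ)) := by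
  intro C_A hCA
  obtain ⟨C_h0, hHop⟩ := stub_hoppingWeightedBounds C_A hCA
  obtain ⟨C_F0, c_F, hcF, hFree⟩ := stub_freeColumnProfile
  obtain ⟨M0, hMom⟩ := stub_freeWeightedMoments
  set C_h : ℝ := max C_h0 0 with hCh
  set C_F : ℝ := max C_F0 0 with hCF
  set M : ℝ := max M0 0 with hMdef
  have hCh0 : 0 ≤ C_h := le_max_right _ _
  have hM0 : 0 ≤ M := le_max_right _ _
  refine ⟨2 * (3072 * C_A * C_F ^ 2 * M) + 144 * C_h * C_F ^ 2 * M, ?_⟩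
  intro L _ W m hm x δ hδ hdef σ τ hσ hσL hτ hτL
  show ‖∑ a : Fin 3, ∑ α : Fin 4, (NormedSpace.exp (-(σ : ℂ) •
      ((wilsonDirac (fundamentalRep (Fin 3)) (freeCfg L) m 1)ᴴ * wilsonDirac (fundamentalRep (Fin 3)) (freeCfg L) m 1)) *
      ((wilsonDirac (fundamentalRep (Fin 3)) W m 1)ᴴ * wilsonDirac (fundamentalRep (Fin 3)) W m 1 -
        (wilsonDirac (fundamentalRep (Fin 3)) (freeCfg L) m 1)ᴴ * wilsonDirac (fundamentalRep (Fin 3)) (freeCfg L) m 1) *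
      NormedSpace.exp (-(τ : ℂ) •
        ((wilsonDirac (fundamentalRep (Fin 3)) (freeCfg L) m 1)ᴴ * wilsonDirac (fundamentalRep (Fin 3)) (freeCfg L) m 1)))
      (x, a, α) (x, a, α)‖ ≤ (2 * (3072 * C_A * C_F ^ 2 * M) + 144 * C_h * C_F ^ 2 * M) * δ ^ 2 /
        Real.sqrt ((1 + σ) * (1 + τ))
  set D : Matrix (TorusSite 4 L × Fin 3 × Fin 4) (TorusSite 4 L × Fin 3 × Fin 4) ℂ :=
    wilsonDirac (fundamentalRep (Fin 3)) W m 1 with hD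
  set D₁ : Matrix (TorusSite 4 L × Fin 3 × Fin 4) (TorusSite 4 L × Fin 3 × Fin 4) ℂ :=
    wilsonDirac (fundamentalRep (Fin 3)) (freeCfg L) m 1 with hD₁
  set Kσ : Matrix (TorusSite 4 L × Fin 3 × Fin 4) (TorusSite 4 L × Fin 3 × Fin 4) ℂ :=
    NormedSpace.exp (-(σ : ℂ) • (D₁ᴴ * D₁)) with hKσ
  set Kτ : Matrix (TorusSite 4 L × Fin 3 × Fin 4) (TorusSite 4 L × Fin 3 × Fin 4) ℂ :=
    NormedSpace.exp (-(τ : ℂ) • (D₁ᴴ * D₁)) with hKτ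
  have hHσ : Kσᴴ = Kσ := (isHermitian_exp_neg_smul D₁ σ).eq
  have hHτ : Kτᴴ = Kτ := (isHermitian_exp_neg_smul D₁ τ).eq
  have h1σ : 0 < 1 + σ := by linarith
  have h1τ : 0 < 1 + τ := by linarith
  /- free profiles without the mass factor -/
  have hprof : ∀ s : ℝ, 0 ≤ s → s ≤ (L : ℝ) ^ 2 → ∀ (z : TorusSite 4 L) (b : Fin 3) (β : Fin 4) (a : Fin 3) (α : Fin 4),
      ‖(NormedSpace.exp (-(s : ℂ) • (D₁ᴴ * D₁))) (z, b, β) (x, a, α)‖ ≤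
          C_F * ((1 + s) / (1 + s + (torusDist x z : ℝ) ^ 2) ^ 3) ∧
      ‖(D₁ * NormedSpace.exp (-(s : ℂ) • (D₁ᴴ * D₁))) (z, b, β) (x, a, α)‖ ≤
          C_F * (Real.sqrt (1 + s) / (1 + s + (torusDist x z : ℝ) ^ 2) ^ 3) := by
    intro s hs hsL z b β a α
    have h := hFree L m hm s hs hsL x z a b α β
    have ht : 0 ≤ c_F * s * m ^ 2 := by have := hcF.le; positivity
    have hP : 0 ≤ (1 + s + (torusDist x z : ℝ) ^ 2) ^ 3 := by positivity
    exact ⟨h.1.trans (const_exp_mul_div_le ht (by linarith) hP),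
      h.2.trans (const_exp_mul_div_le ht (Real.sqrt_nonneg _) hP)⟩
  /- weighted moments with the nonnegative constant -/
  have hmomA : ∀ s : ℝ, 0 ≤ s → ∑ z : TorusSite 4 L, ((torusDist x z : ℝ) + 3) ^ 2 *
      ((1 + s) / (1 + s + (torusDist x z : ℝ) ^ 2) ^ 3) ^ 2 ≤ M / (1 + s) := by
    intro s hs
    have h1s : 0 < 1 + s := by linarith
    have hle : M0 / (1 + s) ≤ M / (1 + s) := div_le_div_of_nonneg_right (le_max_left M0 0) h1s.le
    exact (hMom L x s hs).1.trans hle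
  have hmomB : ∀ s : ℝ, 0 ≤ s → ∑ z : TorusSite 4 L, ((torusDist x z : ℝ) + 3) ^ 2 *
      (Real.sqrt (1 + s) / (1 + s + (torusDist x z : ℝ) ^ 2) ^ 3) ^ 2 ≤ M / (1 + s) := by
    intro s hs
    have h1s : 0 < 1 + s := by linarith
    have hle1 : M0 / (1 + s) ^ 2 ≤ M / (1 + s) ^ 2 :=
      div_le_div_of_nonneg_right (le_max_left M0 0) (by positivity)
    have hle2 : M / (1 + s) ^ 2 ≤ M / (1 + s) := div_le_div_of_nonneg_left hM0 h1s (by nlinarith)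
    exact (hMom L x s hs).2.1.trans (hle1.trans hle2)
  /- the two first-order terms -/
  have h1 : ‖∑ a : Fin 3, ∑ α : Fin 4, ((D₁ * Kσ)ᴴ * (D - D₁) * Kτ) (x, a, α) (x, a, α)‖ ≤
      3072 * C_A * C_F ^ 2 * M * δ ^ 2 / Real.sqrt ((1 + σ) * (1 + τ)) :=
    norm_firstOrder_traced_le W m x hCA hM0 hσ hτ hdef (fun z β α => (hprof σ hσ hσL z 0 β 0 α).2)
      (fun z β α => (hprof τ hτ hτL z 0 β 0 α).1) (hmomB σ hσ) (hmomA τ hτ)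
  have h2 : ‖∑ a : Fin 3, ∑ α : Fin 4, (((D₁ * Kτ)ᴴ * (D - D₁) * Kσ)ᴴ) (x, a, α) (x, a, α)‖ ≤
      3072 * C_A * C_F ^ 2 * M * δ ^ 2 / Real.sqrt ((1 + σ) * (1 + τ)) := by
    have hstar : ∑ a : Fin 3, ∑ α : Fin 4, (((D₁ * Kτ)ᴴ * (D - D₁) * Kσ)ᴴ) (x, a, α) (x, a, α) =
        star (∑ a : Fin 3, ∑ α : Fin 4, ((D₁ * Kτ)ᴴ * (D - D₁) * Kσ) (x, a, α) (x, a, α)) := by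
      rw [star_sum]
      refine Finset.sum_congr rfl fun a _ => ?_
      rw [star_sum]
      rfl
    rw [hstar, norm_star, mul_comm (1 + σ)]
    exact norm_firstOrder_traced_le W m x hCA hM0 hτ hσ hdef (fun z β α => (hprof τ hτ hτL z 0 β 0 α).2)
      (fun z β α => (hprof σ hσ hσL z 0 β 0 α).1) (hmomB τ hτ) (hmomA σ hσ)
  /- the two-vertex term -/
  have hcol : ∀ s : ℝ, 0 ≤ s → s ≤ (L : ℝ) ^ 2 → ∀ (a : Fin 3) (α : Fin 4),
      ∑ q, ‖((D - D₁) * NormedSpace.exp (-(s : ℂ) • (D₁ᴴ * D₁))) q (x, a, α)‖ ^ 2 ≤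
        (12 * C_h * C_F ^ 2 * M * δ ^ 2) / (1 + s) := by
    intro s hs hsL a α
    have hw : ∀ z : TorusSite 4 L, 0 ≤ ((torusDist x z : ℝ) + 3) ^ 2 := fun z => by positivity
    have hH := (hHop L W m x δ hδ hdef (fun q => (NormedSpace.exp (-(s : ℂ) • (D₁ᴴ * D₁))) q (x, a, α))).1
    have hS := sum_weight_norm_sq_le_of_profile (fun q => (NormedSpace.exp (-(s : ℂ) • (D₁ᴴ * D₁))) q (x, a, α))
      (fun z => ((torusDist x z : ℝ) + 3) ^ 2) (fun z => (1 + s) / (1 + s + (torusDist x z : ℝ) ^ 2) ^ 3) hw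
      (fun z b β => (hprof s hs hsL z b β a α).1)
    have hS0 : 0 ≤ ∑ q : TorusSite 4 L × Fin 3 × Fin 4, ((torusDist x q.1 : ℝ) + 3) ^ 2 *
        ‖(NormedSpace.exp (-(s : ℂ) • (D₁ᴴ * D₁))) q (x, a, α)‖ ^ 2 := Finset.sum_nonneg fun q _ => by positivity
    simp only [mul_apply_eq_mulVec_col]
    calc _ ≤ C_h0 * δ ^ 2 * ∑ q : TorusSite 4 L × Fin 3 × Fin 4, ((torusDist x q.1 : ℝ) + 3) ^ 2 *
          ‖(NormedSpace.exp (-(s : ℂ) • (D₁ᴴ * D₁))) q (x, a, α)‖ ^ 2 := hH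
      _ ≤ C_h * δ ^ 2 * ∑ q : TorusSite 4 L × Fin 3 × Fin 4, ((torusDist x q.1 : ℝ) + 3) ^ 2 *
          ‖(NormedSpace.exp (-(s : ℂ) • (D₁ᴴ * D₁))) q (x, a, α)‖ ^ 2 :=
          mul_le_mul_of_nonneg_right (mul_le_mul_of_nonneg_right (le_max_left _ _) (sq_nonneg _)) hS0
      _ ≤ C_h * δ ^ 2 * (12 * C_F ^ 2 * (M / (1 + s))) :=
          mul_le_mul_of_nonneg_left (hS.trans (mul_le_mul_of_nonneg_left (hmomA s hs) (by positivity)))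
            (by positivity)
      _ = (12 * C_h * C_F ^ 2 * M * δ ^ 2) / (1 + s) := by ring
  have h3 : ‖∑ a : Fin 3, ∑ α : Fin 4, (((D - D₁) * Kσ)ᴴ * ((D - D₁) * Kτ)) (x, a, α) (x, a, α)‖ ≤
      144 * C_h * C_F ^ 2 * M * δ ^ 2 / Real.sqrt ((1 + σ) * (1 + τ)) := by
    refine (norm_sum_conjTranspose_mul_apply_le _ _ x (hcol σ hσ hσL) (hcol τ hτ hτL)).trans (le_of_eq ?_)
    rw [sqrt_div_mul_sqrt_div (by positivity) hσ hτ]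
    ring
  /- assembly -/
  rw [heat_vertex_split_traced D D₁ Kσ Kτ hHσ hHτ]
  simp only [Matrix.add_apply, Finset.sum_add_distrib]
  refine (norm_add₃_le).trans ((add_le_add (add_le_add h1 h2) h3).trans (le_of_eq ?_))
  ring

end Assembly

end Summit.QuantumFields.QCD.Cruxes.TracedQuadraticParametrix.Sketch

end
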